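import Summits.KontsevichZagierPeriods.KontsevichZagierPeriods.Theorems.OctahedralSymmetryOctahedralSpanAllWeightsStubWeightTwo

/-!
# Crux `OctahedralSpanAllWeights` (stmt-KontsevichZagierPeriods-9659), line `Sketch`:
# certificates WITH REFERENCES (helper for stub `stub_weight_four`)

The reflection checker of `OctahedralSymmetryOctahedralSpanAllWeightsStubWeightTwo` certifies a
convergent word `W` of length `w` by an identity `[W] − Σ y_V [V] = Σ x_g vec(g)` over two-letter
words `V`. From weight 4 on such REFERENCE-FREE certificates are too large for the kernel (the dense
elimination gives `1.5 · 10⁶` expansion terms at weight 4), whereas certificates that may also CITE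
words certified earlier in the table,
`[W] − Σ y_V [V] − Σ z_U [U] = Σ x_g vec(g)` (`V` two-letter, `U` earlier, `g` generator terms),
are small (at weight 4: one generator for 358 of the 384 words). This file adds that layer:
* `RCert` (word, two-letter part `nf`, references `refs`, generator terms `gens`), its expansion
  `RCert.fvec` and checker `RCert.ok w earlier` (references must lie in the list `earlier`), with
  soundness `RCert.sound` relative to `earlier ⊆ rel ⊔ twoSpan w`;
* `rtableOk w earlier T`, checking a table in order while threading the certified words, the list
  `RCert.after T earlier` of words certified after it, and the registered helper stub
  `rtable_sound` (induction along the table);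
* `twoLetterNormalForm_of_words` (certified words covering the convergent non-two-letter words give
  `TwoLetterNormalForm w`) and the `ℤ`-scaled row format `ZRCert` / `ZRCert.toRCert` in which the
  weight-4 tables (`…StubWeightFourTableA/B/C`) are written.
Everything is generic in `w`; the kernel work is done in the table files (`decide +kernel`).

Sources: J. Zhao, Doc. Math. 15 (2010), §2, §5; J. Zhao, C. R. Acad. Sci. Paris 346 (2008), §4
(the relation families); the reflection set-up is that of `…StubWeightTwo` and of
`LinRedNormalFormHoffmanSpanInKZRefCert` (this tree: certificates with references).
-/

namespace Summit.KontsevichZagierPeriods.OctahedralSymmetry.OctaSpan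

open Literature.NumberTheory.Transcendental Literature.NumberTheory.Transcendental.LevelFour
open FVec5

/-- A certificate WITH REFERENCES for one convergent word: the word, the two-letter part `nf`,
the cited earlier-certified words `refs`, and generator terms `gens`, claiming
`[word] − Σ nf − Σ refs = Σ x_g vec(g)`. [folklore] -/
structure RCert where
  /-- the word -/
  word : List (Fin 5)
  /-- two-letter words with coefficients -/
  nf : FVec5
  /-- earlier-certified words with coefficients -/
  refs : FVec5
  /-- generator terms with coefficients -/
  gens : List (GenTerm × ℚ)

namespace RCert

/-- The formal expansion of `[word] − (Σ nf + Σ refs + Σ x_g vec(g))`. [folklore] -/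
def fvec (c : RCert) : FVec5 :=
  (c.word, 1) :: smul (-1) (c.nf ++ c.refs ++ c.gens.flatMap fun p => smul p.2 p.1.vecF)

/-- **The checker**, relative to the list `earlier` of already certified words: `nf` words are
two-letter words of length `w`, `refs` words lie in `earlier`, generator terms pass `GenTerm.ok`,
and the expansion vanishes (radix test). [folklore] -/
def ok (w : ℕ) (earlier : List (List (Fin 5))) (c : RCert) : Bool :=
  c.nf.all (fun p => decide (p.1.length = w ∧ ∀ a ∈ p.1, a = 1 ∨ a = 3)) &&
    (c.refs.all (fun p => decide (p.1 ∈ earlier)) &&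
      (c.gens.all (fun p => p.1.ok) && zeroTest (w + 1) c.fvec))

/-- The expansion realises to the difference of the two sides of the identity. [folklore] -/
theorem eval_fvec (c : RCert) : eval c.fvec =
    sym c.word - (eval c.nf + eval c.refs + (c.gens.map fun p => p.2 • eval p.1.vecF).sum) := by
  simp only [fvec, eval_cons, eval_smul, eval_append, eval_flatMap, one_smul, neg_one_smul]
  abel

/-- **Soundness of one referenced certificate**: if the cited words are in `rel ⊔ twoSpan w`, so
is the certified word. [folklore] -/
theorem sound (w : ℕ) (earlier : List (List (Fin 5))) (c : RCert) (h : c.ok w earlier = true)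
    (hE : ∀ U ∈ earlier, sym U ∈ rel ⊔ twoSpan w) : sym c.word ∈ rel ⊔ twoSpan w := by
  simp only [ok, Bool.and_eq_true, List.all_eq_true, decide_eq_true_eq] at h
  obtain ⟨hnf, hrefs, hg, hz⟩ := h
  have h0 := eval_eq_zero_of_zeroTest hz
  rw [eval_fvec, sub_eq_zero] at h0
  rw [h0]
  refine add_mem (add_mem ?_ ?_) ?_
  · refine Submodule.mem_sup_right (list_sum_mem fun x hx => ?_)
    obtain ⟨p, hp, rfl⟩ := List.mem_map.1 hx
    refine Submodule.smul_mem _ _ (Submodule.subset_span ⟨p.1, ?_, rfl⟩)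
    exact Finset.mem_coe.2 ((mem_twoWords_iff w p.1).2 (hnf p hp))
  · refine list_sum_mem fun x hx => ?_
    obtain ⟨p, hp, rfl⟩ := List.mem_map.1 hx
    exact Submodule.smul_mem _ _ (hE p.1 (hrefs p hp))
  · refine Submodule.mem_sup_left (list_sum_mem fun x hx => ?_)
    obtain ⟨p, hp, rfl⟩ := List.mem_map.1 hx
    exact Submodule.smul_mem _ _ (mem_rel_of_isGen (GenTerm.isGen_eval p.1 (hg p hp)))

/-- The certified words after checking the table `T` on top of `earlier` (most recent first).
[folklore] -/
def after (T : List RCert) (earlier : List (List (Fin 5))) : List (List (Fin 5)) :=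
  (T.map RCert.word).reverse ++ earlier

end RCert

/-- **The table checker**: check the certificates in order, threading the certified words.
[folklore] -/
def rtableOk (w : ℕ) : List (List (Fin 5)) → List RCert → Bool
  | _, [] => true
  | earlier, c :: T => c.ok w earlier && rtableOk w (c.word :: earlier) T

/-- One step of the table: `after (c :: T) earlier = after T (c.word :: earlier)`. [folklore] -/
theorem RCert.after_cons (c : RCert) (T : List RCert) (earlier : List (List (Fin 5))) :
    RCert.after (c :: T) earlier = RCert.after T (c.word :: earlier) := by
  simp [RCert.after]

/-- **Soundness of a checked table** (registered helper stub `rtable_sound`): if `rtableOk`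
accepts `T` on top of `earlier` and the words of `earlier` are in `rel ⊔ twoSpan w`, then so are
all words certified after `T`. [folklore] -/
theorem rtable_sound (w : ℕ) (earlier : List (List (Fin 5))) (T : List RCert)
    (hT : rtableOk w earlier T = true) (hE : ∀ U ∈ earlier, sym U ∈ rel ⊔ twoSpan w) :
    ∀ U ∈ RCert.after T earlier, sym U ∈ rel ⊔ twoSpan w := by
  induction T generalizing earlier with
  | nil => simpa [RCert.after] using hE
  | cons c T ih =>
    simp only [rtableOk, Bool.and_eq_true] at hT
    rw [RCert.after_cons]
    refine ih (c.word :: earlier) hT.2 fun U hU => ?_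
    rcases List.mem_cons.1 hU with rfl | hU
    · exact RCert.sound w earlier c hT.1 hE
    · exact hE U hU

/-- **From certified words to the normal form**: if every convergent word of length `w` is a
two-letter word or a certified word, then `TwoLetterNormalForm w`. [folklore] -/
theorem twoLetterNormalForm_of_words (w : ℕ) (words : List (List (Fin 5)))
    (hwords : ∀ U ∈ words, sym U ∈ rel ⊔ twoSpan w)
    (hcover : ∀ W ∈ allWords w, IsConvergent W → (∀ a ∈ W, a = 1 ∨ a = 3) ∨ W ∈ words) :
    TwoLetterNormalForm w := by
  intro W hlen hW
  subst hlen
  rcases hcover W (mem_allWords W) hW with h2 | hmem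
  · exact Submodule.mem_sup_right (Submodule.subset_span
      ⟨W, Finset.mem_coe.2 ((mem_twoWords_iff _ W).2 ⟨rfl, h2⟩), rfl⟩)
  · exact hwords W hmem

/-- A `ℤ`-scaled referenced certificate `⟨word, den, nf, refs, gens⟩`: one common denominator
`den`, integer coefficients (cheap to elaborate as a literal). [folklore] -/
structure ZRCert where
  /-- the word -/
  word : List (Fin 5)
  /-- the common denominator -/
  den : ℕ
  /-- two-letter part, scaled by `den` -/
  nf : List (List (Fin 5) × ℤ)
  /-- references, scaled by `den` -/
  refs : List (List (Fin 5) × ℤ)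
  /-- generator terms, scaled by `den` -/
  gens : List (GenTerm × ℤ)

/-- The referenced certificate of a `ℤ`-scaled row (divide every coefficient by `den`).
[folklore] -/
def ZRCert.toRCert (z : ZRCert) : RCert :=
  ⟨z.word, z.nf.map fun p => (p.1, (p.2 : ℚ) / z.den), z.refs.map fun p => (p.1, (p.2 : ℚ) / z.den),
    z.gens.map fun p => (p.1, (p.2 : ℚ) / z.den)⟩

/-- Smoke test (kernel): the one-row table certifying `[2,2,2,2]` (poles `−1,−1,−1,−1`) by the
squaring map alone, `[2,2,2,2] − Σ_{V ∈ {1,3}⁴} [V] = dilGen [2,2,2,2]`. [folklore] -/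
example : rtableOk 4 [] [ZRCert.toRCert ⟨[2, 2, 2, 2], 1,
    [([1, 1, 1, 1], 1), ([1, 1, 1, 3], 1), ([1, 1, 3, 1], 1), ([1, 1, 3, 3], 1), ([1, 3, 1, 1], 1),
     ([1, 3, 1, 3], 1), ([1, 3, 3, 1], 1), ([1, 3, 3, 3], 1), ([3, 1, 1, 1], 1), ([3, 1, 1, 3], 1),
     ([3, 1, 3, 1], 1), ([3, 1, 3, 3], 1), ([3, 3, 1, 1], 1), ([3, 3, 1, 3], 1), ([3, 3, 3, 1], 1),
     ([3, 3, 3, 3], 1)], [], [(.dil [2, 2, 2, 2], 1)]⟩] = true := by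
  decide +kernel

end Summit.KontsevichZagierPeriods.OctahedralSymmetry.OctaSpan
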